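import Literature.Geometry.Lorentzian.LocalConstraintDeformationMoncrief
import HarnessLib

/-!
# `ChruscielDelay_localConstraintDeformation` from the analytic core on SMALL balls

Sequel of `LocalConstraintDeformationReduction.lean` / `LocalConstraintDeformationMoncrief.lean`
(everything PROVED; no definition, no statement of `Prop` type; the analytic core is a HYPOTHESIS
spelled out in place). The fact `ChruscielDelay_localConstraintDeformation` lets US choose the
neighbourhood `U ∋ x₀` inside the given `V`; hence the analytic core `(A)` (Chruściel–Delay 2003,
Thm. 5.9 / Prop. 5.10 / Cor. 5.11 in one chart: KID-free coordinate vacuum data on a ball admit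
compactly supported vacuum deformation families with prescribed kernel tangents) is only needed on
balls `ball z₀ ρ` of radius `ρ ≤ ρ₁`, where `ρ₁ > 0` may depend on the coordinate data `(G, K)`
near `z₀` (but not on the number or choice of kernel tangents). This is the form `(A')` below
(`ChruscielDelay_localConstraintDeformation_of_coordCoreSmall`, with the Moncrief core `(M)` as
in the parent file, and `ChruscielDelay_localConstraintDeformation_of_coordCoreASmall`, with
`(M)` discharged by `ChruscielDelay_noKID_of_noKilling`). On small balls the rescaled data
`(G(z₀ + ρy), ρK(z₀ + ρy))` are `C^∞`-close to flat data, which is the regime of the perturbative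
constructions (explicit solution operators for the flat linearised constraint operator with
prescribed support, Mao–Oh–Tao 2023; Corvino–Schoen 2006, §3) as well as of the weighted theory
of Chruściel–Delay with uniform constants.

The proof is that of `ChruscielDelay_localConstraintDeformation_of_coordCore` verbatim, except
that `ρ₁` is obtained from `(A')` for the chart readings of `Φ^* D` first and the ball is chosen
with `ρ ≤ min ρ₀ ρ₁`.

## References

* P. T. Chruściel, E. Delay, Mém. Soc. Math. Fr. 94 (2003), Thm. 5.9, Prop. 5.10, Cor. 5.11.
  [ChruscielDelay2003]
* J. Corvino, R. Schoen, J. Differential Geom. 73 (2006), Thm. 2 and §3. [CorvinoSchoen2006]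
* V. Moncrief, J. Math. Phys. 16 (1975), 493–498. [Moncrief1975]
-/

noncomputable section

set_option maxSynthPendingDepth 3

open Bundle Set Function Filter TopologicalSpace Manifold Module Metric
open scoped Manifold ContDiff Topology

namespace Literature.Geometry.Lorentzian

/-- **`ChruscielDelay_localConstraintDeformation` from `(M)` and the small-ball analytic core
`(A')`** — see the module docstring. [cite: ChruscielDelay2003, Thm. 5.9, Prop. 5.10 and Cor. 5.11] -/
theorem ChruscielDelay_localConstraintDeformation_of_coordCoreSmall {ι : Type} [Fintype ι]
    (b₀ : Basis ι ℝ E3)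
    (hM : ∀ (X : Type) [TopologicalSpace X] [ChartedSpace E3 X] [IsManifold (𝓡 3) ∞ X]
      [T2Space X] [SecondCountableTopology X] [ConnectedSpace X]
      (D : InitialDataSet (𝓡 3) X) (𝒟 : VacuumCauchyDevelopment D) (x₀ : X),
      (∀ [D.metric.HasLeviCivita], D.IsVacuumConstraintSolution) →
      (haveI : 𝒟.metric.toPseudoRiemannianMetric.HasLeviCivita := 𝒟.metric.hasLeviCivita
        ∀ V : Set X, IsOpen V → IsConnected V → x₀ ∈ V →
          ∀ W : Set 𝒟.carrier, IsOpen W → 𝒟.embed '' V ⊆ W →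
            ∀ ξ : (p : 𝒟.carrier) → TangentSpace (𝓡 4) p,
              ContMDiffOn (𝓡 4) ((𝓡 4).prod 𝓘(ℝ, E4)) ∞
                (fun p ↦ (Bundle.TotalSpace.mk' E4 p (ξ p) : TangentBundle (𝓡 4) 𝒟.carrier)) W →
              (∀ p ∈ W, ∀ Y₀ Z₀ : TangentSpace (𝓡 4) p,
                𝒟.metric.val p (𝒟.metric.toPseudoRiemannianMetric.leviCivita ξ p Y₀) Z₀ +
                  𝒟.metric.val p Y₀ (𝒟.metric.toPseudoRiemannianMetric.leviCivita ξ p Z₀) = 0) →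
              ∀ x ∈ V, ξ (𝒟.embed x) = 0) →
      ∃ ρ₀ : ℝ, 0 < ρ₀ ∧ closedBall (chartAt E3 x₀ x₀) ρ₀ ⊆ (chartAt E3 x₀).target ∧
        ∀ ρ : ℝ, 0 < ρ → ρ ≤ ρ₀ →
          ∀ (N : E3 → ℝ) (Y : E3 → E3),
            ContDiffOn ℝ ∞ N (ball (chartAt E3 x₀ x₀) ρ) →
            ContDiffOn ℝ ∞ Y (ball (chartAt E3 x₀ x₀) ρ) →
            (∀ z ∈ ball (chartAt E3 x₀ x₀) ρ,
              MetricCoord.adjHamG (D.comap _ (ChartInverse.contMDiff_symm x₀) (ChartInverse.injective_mfderiv_symm x₀)).coordHOn (D.comap _ (ChartInverse.contMDiff_symm x₀) (ChartInverse.injective_mfderiv_symm x₀)).coordKOn N z + MetricCoord.adjMomGS (D.comap _ (ChartInverse.contMDiff_symm x₀) (ChartInverse.injective_mfderiv_symm x₀)).coordHOn (D.comap _ (ChartInverse.contMDiff_symm x₀) (ChartInverse.injective_mfderiv_symm x₀)).coordKOn Y z = 0 ∧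
              MetricCoord.adjHamK (D.comap _ (ChartInverse.contMDiff_symm x₀) (ChartInverse.injective_mfderiv_symm x₀)).coordHOn (D.comap _ (ChartInverse.contMDiff_symm x₀) (ChartInverse.injective_mfderiv_symm x₀)).coordKOn N z + MetricCoord.adjMomKS (D.comap _ (ChartInverse.contMDiff_symm x₀) (ChartInverse.injective_mfderiv_symm x₀)).coordHOn Y z = 0) →
            ∀ z ∈ ball (chartAt E3 x₀ x₀) ρ, N z = 0 ∧ Y z = 0)
    (hA : ∀ (T : Set E3) (z₀ : E3), IsOpen T → z₀ ∈ T →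
      ∀ (G K : E3 → E3 →L[ℝ] E3 →L[ℝ] ℝ), MetricCoord.IsMetricOn G T →
        (∀ z ∈ T, ∀ v : E3, v ≠ 0 → 0 < G z v v) →
        ContDiffOn ℝ ∞ K T → (∀ z ∈ T, ∀ v w : E3, K z v w = K z w v) →
        (∀ z ∈ T, MetricCoord.hamAt G K z = 0 ∧ ∀ Z : E3, MetricCoord.momFn b₀ G K z Z = 0) →
        ∃ ρ₁ : ℝ, 0 < ρ₁ ∧ ∀ (k : ℕ) (ρ : ℝ), 0 < ρ → ρ ≤ ρ₁ → closedBall z₀ ρ ⊆ T →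
        (∀ (N : E3 → ℝ) (Y : E3 → E3),
          ContDiffOn ℝ ∞ N (ball z₀ ρ) → ContDiffOn ℝ ∞ Y (ball z₀ ρ) →
          (∀ z ∈ ball z₀ ρ,
            MetricCoord.adjHamG G K N z + MetricCoord.adjMomGS G K Y z = 0 ∧
            MetricCoord.adjHamK G K N z + MetricCoord.adjMomKS G Y z = 0) →
          ∀ z ∈ ball z₀ ρ, N z = 0 ∧ Y z = 0) →
        ∀ (γ κ : Fin k → E3 → E3 →L[ℝ] E3 →L[ℝ] ℝ),
          (∀ j, ContDiffOn ℝ ∞ (γ j) T ∧ ContDiffOn ℝ ∞ (κ j) T ∧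
            (∀ z v w, γ j z v w = γ j z w v) ∧ (∀ z v w, κ j z v w = κ j z w v) ∧
            (∃ Kc : Set E3, IsCompact Kc ∧ Kc ⊆ ball z₀ ρ ∧ ∀ z, z ∉ Kc → γ j z = 0 ∧ κ j z = 0) ∧
            ∀ z ∈ T, MetricCoord.linHamFn b₀ G K (γ j) (κ j) z = 0 ∧
              ∀ Z : E3, MetricCoord.linMomFn b₀ G K (γ j) (κ j) z Z = 0) →
          ∃ (r : ℝ) (Gf Kf : EuclideanSpace ℝ (Fin k) → E3 → E3 →L[ℝ] E3 →L[ℝ] ℝ), 0 < r ∧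
            ContDiffOn ℝ ∞ (fun q : EuclideanSpace ℝ (Fin k) × E3 ↦ Gf q.1 q.2) (ball 0 r ×ˢ T) ∧
            ContDiffOn ℝ ∞ (fun q : EuclideanSpace ℝ (Fin k) × E3 ↦ Kf q.1 q.2) (ball 0 r ×ˢ T) ∧
            (∀ z ∈ T, Gf 0 z = G z ∧ Kf 0 z = K z) ∧
            (∀ c ∈ ball (0 : EuclideanSpace ℝ (Fin k)) r, ∀ z ∈ T, z ∉ closedBall z₀ ρ →
              Gf c z = G z ∧ Kf c z = K z) ∧
            (∀ c ∈ ball (0 : EuclideanSpace ℝ (Fin k)) r, ∀ z ∈ T, ∀ v w : E3,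
              Gf c z v w = Gf c z w v ∧ Kf c z v w = Kf c z w v) ∧
            (∀ c ∈ ball (0 : EuclideanSpace ℝ (Fin k)) r, ∀ z ∈ T,
              MetricCoord.hamAt (Gf c) (Kf c) z = 0 ∧
                ∀ Z : E3, MetricCoord.momFn b₀ (Gf c) (Kf c) z Z = 0) ∧
            ∀ j, ∀ z ∈ T, deriv (fun s : ℝ ↦ Gf (EuclideanSpace.single j s) z) 0 = γ j z ∧
              deriv (fun s : ℝ ↦ Kf (EuclideanSpace.single j s) z) 0 = κ j z) :
    ChruscielDelay_localConstraintDeformation := by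
  refine ChruscielDelay_localConstraintDeformation_of_localFamily ?_
  intro X _ _ _ _ _ _ D 𝒟 x₀ hvac hKID V hV hx₀
  -- (M): no coordinate KIDs on small balls around `c x₀`
  obtain ⟨ρ₀, hρ₀, -, hnoKID⟩ := hM X D 𝒟 x₀ hvac hKID
  -- the readings of `Φ^* D`: smooth Riemannian coordinate-vacuum data on the target
  have hmet : MetricCoord.IsMetricOn (D.comap _ (ChartInverse.contMDiff_symm x₀) (ChartInverse.injective_mfderiv_symm x₀)).coordHOn (chartAt E3 x₀).target :=
    InitialDataSet.isMetricOn_coordHOn _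
  have hGpos : ∀ z ∈ (chartAt E3 x₀).target, ∀ v : E3, v ≠ 0 → 0 < (D.comap _ (ChartInverse.contMDiff_symm x₀) (ChartInverse.injective_mfderiv_symm x₀)).coordHOn z v v :=
    fun z hz v hv ↦ InitialDataSet.coordHOn_pos _ hz v hv
  have hKsm : ContDiffOn ℝ ∞ (D.comap _ (ChartInverse.contMDiff_symm x₀) (ChartInverse.injective_mfderiv_symm x₀)).coordKOn (chartAt E3 x₀).target := InitialDataSet.contDiffOn_coordKOn' _
  have hKsy : ∀ z ∈ (chartAt E3 x₀).target, ∀ v w : E3, (D.comap _ (ChartInverse.contMDiff_symm x₀) (ChartInverse.injective_mfderiv_symm x₀)).coordKOn z v w = (D.comap _ (ChartInverse.contMDiff_symm x₀) (ChartInverse.injective_mfderiv_symm x₀)).coordKOn z w v :=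
    fun z _ v w ↦ InitialDataSet.coordKOn_symm _ z v w
  have hcv : ∀ z ∈ (chartAt E3 x₀).target, MetricCoord.hamAt (D.comap _ (ChartInverse.contMDiff_symm x₀) (ChartInverse.injective_mfderiv_symm x₀)).coordHOn (D.comap _ (ChartInverse.contMDiff_symm x₀) (ChartInverse.injective_mfderiv_symm x₀)).coordKOn z = 0 ∧
      ∀ Z : E3, MetricCoord.momFn b₀ (D.comap _ (ChartInverse.contMDiff_symm x₀) (ChartInverse.injective_mfderiv_symm x₀)).coordHOn (D.comap _ (ChartInverse.contMDiff_symm x₀) (ChartInverse.injective_mfderiv_symm x₀)).coordKOn z Z = 0 :=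
    fun z hz ↦ InitialDataSet.coordVacuum_comap_chart x₀ D hvac b₀ hz
  -- (A), first half: the radius `ρ₁` below which the analysis works
  obtain ⟨ρ₁, hρ₁, hA₁⟩ := hA (chartAt E3 x₀).target (chartAt E3 x₀ x₀) (chartAt E3 x₀).open_target
    (mem_chart_target E3 x₀) _ _ hmet hGpos hKsm hKsy hcv
  -- the ball: `closedBall (c x₀) ρ ⊆ target`, `Φ(B̄) ⊆ V`, `ρ ≤ min ρ₀ ρ₁`
  obtain ⟨ρ, hρ, hρle', hρT, hρV⟩ :=
    InitialDataSet.exists_chart_closedBall_subset x₀ hV hx₀ (lt_min hρ₀ hρ₁)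
  have hρle : ρ ≤ ρ₀ := hρle'.trans (min_le_left _ _)
  have hρle₁ : ρ ≤ ρ₁ := hρle'.trans (min_le_right _ _)
  have hBT : ball (chartAt E3 x₀ x₀) ρ ⊆ (chartAt E3 x₀).target := ball_subset_closedBall.trans hρT
  refine ⟨(chartAt E3 x₀).symm '' ball (chartAt E3 x₀ x₀) ρ,
    (chartAt E3 x₀).isOpen_image_symm_of_subset_target isOpen_ball hBT,
    ⟨chartAt E3 x₀ x₀, mem_ball_self hρ, (chartAt E3 x₀).left_inv (mem_chart_source E3 x₀)⟩,
    ?_, ?_⟩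
  · rintro _ ⟨z, hz, rfl⟩
    exact hρV ⟨z, ball_subset_closedBall hz, rfl⟩
  intro k a b K hK hKU hw
  -- the witnessed tangents, read in the chart
  choose γ κ hγs hκs hγsym hκsym hsupp hker hid h0 using
    fun j ↦ InitialDataSet.exists_chartWitness x₀ D K (a j) (b j) (hw j) b₀
  -- `K ⊆ source`, `c(K)` compact `⊆ ball`
  have hKsrc : K ⊆ (chartAt E3 x₀).source := by
    intro p hp
    obtain ⟨z, hz, rfl⟩ := hKU hp
    exact (chartAt E3 x₀).map_target (hBT hz)
  have hKc : IsCompact (chartAt E3 x₀ '' K) :=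
    hK.image_of_continuousOn ((chartAt E3 x₀).continuousOn.mono hKsrc)
  have hKcB : chartAt E3 x₀ '' K ⊆ ball (chartAt E3 x₀ x₀) ρ := by
    rintro _ ⟨p, hp, rfl⟩
    obtain ⟨z, hz, rfl⟩ := hKU hp
    rw [(chartAt E3 x₀).right_inv (hBT hz)]
    exact hz
  have hsupp' : ∀ j, ∀ z : E3, z ∉ chartAt E3 x₀ '' K → γ j z = 0 ∧ κ j z = 0 := fun j z hz ↦
    hsupp j z fun hzT hmem ↦ hz ⟨_, hmem, (chartAt E3 x₀).right_inv hzT⟩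
  -- (A), second half: the coordinate deformation family
  obtain ⟨r, Gf, Kf, hr, hGfs, hKfs, hGf0, hGfoff, hGfsym, hGfcv, hGftan⟩ :=
    hA₁ k ρ hρ hρle₁ hρT (hnoKID ρ hρ hρle) γ κ
      (fun j ↦ ⟨hγs j, hκs j, hγsym j, hκsym j, ⟨_, hKc, hKcB, hsupp' j⟩, hker j⟩)
  -- reassembly on `X`
  obtain ⟨r₁, G₀, hr₁, hr₁r, hhs, hks, hG00, hvac₀, hsupp₀, hsec⟩ :=
    InitialDataSet.exists_localFamily_of_coordFamily x₀ D hvac hρT hr Gf Kf hGfs hKfs hGf0 hGfoff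
      hGfsym b₀ hGfcv
  have hCc : IsCompact ((chartAt E3 x₀).symm '' closedBall (chartAt E3 x₀ x₀) ρ) :=
    (isCompact_closedBall _ _).image_of_continuousOn ((chartAt E3 x₀).continuousOn_symm.mono hρT)
  have hCsrc : (chartAt E3 x₀).symm '' closedBall (chartAt E3 x₀ x₀) ρ ⊆ (chartAt E3 x₀).source := by
    rintro _ ⟨z, hz, rfl⟩
    exact (chartAt E3 x₀).map_target (hρT hz)
  have hGfs₁ : ContDiffOn ℝ ∞ (fun q : EuclideanSpace ℝ (Fin k) × E3 ↦ Gf q.1 q.2)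
      (ball 0 r₁ ×ˢ (chartAt E3 x₀).target) :=
    hGfs.mono (prod_mono (ball_subset_ball hr₁r) Subset.rfl)
  have hKfs₁ : ContDiffOn ℝ ∞ (fun q : EuclideanSpace ℝ (Fin k) × E3 ↦ Kf q.1 q.2)
      (ball 0 r₁ ×ˢ (chartAt E3 x₀).target) :=
    hKfs.mono (prod_mono (ball_subset_ball hr₁r) Subset.rfl)
  refine ⟨r₁, G₀, hr₁, hhs, hks, hG00, hvac₀, ⟨_, hCc, hρV, fun c _ x hx ↦ hsupp₀ c x hx⟩,
    fun j ↦ ⟨?_, ?_⟩⟩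
  · funext p
    by_cases hp : p ∈ (chartAt E3 x₀).source
    · exact (InitialDataSet.deriv_section_eq_pullbackBilin x₀ hr₁ (fun c x ↦ (G₀ c).h.inner x) Gf
        hGfs₁ (fun c hc p hp ↦ (hsec c hc p hp).1) j (fun z hz ↦ (hGftan j z hz).1) hp).trans
        (hid j p hp).1
    · have hpK : p ∉ K := fun h ↦ hp (hKsrc h)
      have hpC : p ∉ (chartAt E3 x₀).symm '' closedBall (chartAt E3 x₀ x₀) ρ := fun h ↦ hp (hCsrc h)
      exact (InitialDataSet.deriv_section_eq_zero (fun c x ↦ (G₀ c).h.inner x) j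
        (fun c ↦ by
          show (G₀ c).h.inner p = (G₀ 0).h.inner p
          rw [(hsupp₀ c p hpC).1, (hsupp₀ 0 p hpC).1])).trans (h0 j p hpK).1.symm
  · funext p
    by_cases hp : p ∈ (chartAt E3 x₀).source
    · exact (InitialDataSet.deriv_section_eq_pullbackBilin x₀ hr₁ (fun c x ↦ (G₀ c).k x) Kf
        hKfs₁ (fun c hc p hp ↦ (hsec c hc p hp).2) j (fun z hz ↦ (hGftan j z hz).2) hp).trans
        (hid j p hp).2
    · have hpK : p ∉ K := fun h ↦ hp (hKsrc h)
      have hpC : p ∉ (chartAt E3 x₀).symm '' closedBall (chartAt E3 x₀ x₀) ρ := fun h ↦ hp (hCsrc h)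
      exact (InitialDataSet.deriv_section_eq_zero (fun c x ↦ (G₀ c).k x) j
        (fun c ↦ by
          show (G₀ c).k p = (G₀ 0).k p
          rw [(hsupp₀ c p hpC).2, (hsupp₀ 0 p hpC).2])).trans (h0 j p hpK).2.symm


/-- **`ChruscielDelay_localConstraintDeformation` from the small-ball analytic core `(A')`
alone** (the Moncrief core is `ChruscielDelay_noKID_of_noKilling`).
[cite: ChruscielDelay2003, Thm. 5.9, Prop. 5.10 and Cor. 5.11] -/
theorem ChruscielDelay_localConstraintDeformation_of_coordCoreASmall {ι : Type} [Fintype ι]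
    (b₀ : Basis ι ℝ E3)
    (hA : ∀ (T : Set E3) (z₀ : E3), IsOpen T → z₀ ∈ T →
      ∀ (G K : E3 → E3 →L[ℝ] E3 →L[ℝ] ℝ), MetricCoord.IsMetricOn G T →
        (∀ z ∈ T, ∀ v : E3, v ≠ 0 → 0 < G z v v) →
        ContDiffOn ℝ ∞ K T → (∀ z ∈ T, ∀ v w : E3, K z v w = K z w v) →
        (∀ z ∈ T, MetricCoord.hamAt G K z = 0 ∧ ∀ Z : E3, MetricCoord.momFn b₀ G K z Z = 0) →
        ∃ ρ₁ : ℝ, 0 < ρ₁ ∧ ∀ (k : ℕ) (ρ : ℝ), 0 < ρ → ρ ≤ ρ₁ → closedBall z₀ ρ ⊆ T →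
        (∀ (N : E3 → ℝ) (Y : E3 → E3),
          ContDiffOn ℝ ∞ N (ball z₀ ρ) → ContDiffOn ℝ ∞ Y (ball z₀ ρ) →
          (∀ z ∈ ball z₀ ρ,
            MetricCoord.adjHamG G K N z + MetricCoord.adjMomGS G K Y z = 0 ∧
            MetricCoord.adjHamK G K N z + MetricCoord.adjMomKS G Y z = 0) →
          ∀ z ∈ ball z₀ ρ, N z = 0 ∧ Y z = 0) →
        ∀ (γ κ : Fin k → E3 → E3 →L[ℝ] E3 →L[ℝ] ℝ),
          (∀ j, ContDiffOn ℝ ∞ (γ j) T ∧ ContDiffOn ℝ ∞ (κ j) T ∧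
            (∀ z v w, γ j z v w = γ j z w v) ∧ (∀ z v w, κ j z v w = κ j z w v) ∧
            (∃ Kc : Set E3, IsCompact Kc ∧ Kc ⊆ ball z₀ ρ ∧ ∀ z, z ∉ Kc → γ j z = 0 ∧ κ j z = 0) ∧
            ∀ z ∈ T, MetricCoord.linHamFn b₀ G K (γ j) (κ j) z = 0 ∧
              ∀ Z : E3, MetricCoord.linMomFn b₀ G K (γ j) (κ j) z Z = 0) →
          ∃ (r : ℝ) (Gf Kf : EuclideanSpace ℝ (Fin k) → E3 → E3 →L[ℝ] E3 →L[ℝ] ℝ), 0 < r ∧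
            ContDiffOn ℝ ∞ (fun q : EuclideanSpace ℝ (Fin k) × E3 ↦ Gf q.1 q.2) (ball 0 r ×ˢ T) ∧
            ContDiffOn ℝ ∞ (fun q : EuclideanSpace ℝ (Fin k) × E3 ↦ Kf q.1 q.2) (ball 0 r ×ˢ T) ∧
            (∀ z ∈ T, Gf 0 z = G z ∧ Kf 0 z = K z) ∧
            (∀ c ∈ ball (0 : EuclideanSpace ℝ (Fin k)) r, ∀ z ∈ T, z ∉ closedBall z₀ ρ →
              Gf c z = G z ∧ Kf c z = K z) ∧
            (∀ c ∈ ball (0 : EuclideanSpace ℝ (Fin k)) r, ∀ z ∈ T, ∀ v w : E3,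
              Gf c z v w = Gf c z w v ∧ Kf c z v w = Kf c z w v) ∧
            (∀ c ∈ ball (0 : EuclideanSpace ℝ (Fin k)) r, ∀ z ∈ T,
              MetricCoord.hamAt (Gf c) (Kf c) z = 0 ∧
                ∀ Z : E3, MetricCoord.momFn b₀ (Gf c) (Kf c) z Z = 0) ∧
            ∀ j, ∀ z ∈ T, deriv (fun s : ℝ ↦ Gf (EuclideanSpace.single j s) z) 0 = γ j z ∧
              deriv (fun s : ℝ ↦ Kf (EuclideanSpace.single j s) z) 0 = κ j z) :
    ChruscielDelay_localConstraintDeformation :=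
  ChruscielDelay_localConstraintDeformation_of_coordCoreSmall b₀ ChruscielDelay_noKID_of_noKilling hA

end Literature.Geometry.Lorentzian

end
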